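import Mathlib
import Summits.ValiantsHypothesis.ValiantsHypothesis.Theorems.LacunarySymmetroidMatrixDescartesFoldLawStubMorseCount
import Summits.ValiantsHypothesis.ValiantsHypothesis.Theorems.LacunarySymmetroidMatrixDescartesFoldLawStubMorsePencil

/-!
# `MatrixDescartes` (stmt-ValiantsHypothesis-18050), line «definite-pair-fold-law» — stub `stub_morse`

The ideator line `Cruxes/MatrixDescartes/Lines/definite_pair_fold_law.lean` (val-idea-2 g2, 2026-08-28) registers
as its theorem-shaped step the **Morse inequality**

  `stub_morse : MorseInequality`,
  `MorseInequality := ∀ m K d P Q, IsDefinitePair P Q → SimpleSpectrum d P Q → (foldSet d P Q).Finite →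
     posRootsCard (pencilDet d (P − Q)) ≤ m + (foldSet d P Q).ncard`:

for a definite pair `(A(x), C(x)) = (Σ_l x^{d_l} P_l, Σ_l x^{d_l} Q_l)` (semidefinite letters, definite sums) with
simple generalized spectrum over `x > 0`, the number of distinct positive roots of `det(A − C)` is at most `m`
plus the number `κ` of fold points `(x, y)`, `x, y > 0`, `Φ = θₓΦ = 0` of the spectral curve
`Φ(x, y) = det(A(x) − y C(x)) = 0`.

PROOF (parts 1–3 are the files `…StubMorseRoots`, `…StubMorseCount`, `…StubMorsePencil`; no implicit function
theorem, no analytic branches).  For `x > 0` the slice `ψ_x = Φ(x, ·) = det(A(x) − X·C(x))` has degree `m`,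
leading coefficient `(−1)^m det C(x)` of constant sign and `m` real roots (`C(x) = RᴴR`, Hermitian spectral
theorem), all simple by `SimpleSpectrum`, hence `m` distinct real roots `y_0(x) < … < y_{m−1}(x)` — continuous in
`x` by IVT bracketing (part 1).  A positive root of `det(A − C) = Φ(·, 1)` is a level-1 crossing of some branch;
between two consecutive crossings of branch `j` the branch has an interior one-sided extremum `c`, and
`∂ₓΦ(c, y_j(c)) = 0` there — otherwise `Φ(·, Y)`, `Y = y_j(c)`, changes sign at its simple zero `c` while the set
of branches above `Y` is the same on both sides, contradicting the sign-parity formula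
`sign Φ(x, Y) = sign lc · (−1)^{#branches above Y}` (part 2).  The folds so obtained are distinct points of
`foldSet` (`y_j(c) > 0` because `A(c) ≻ 0`), whence `Z₊ ≤ Σ_j #crossings_j ≤ m + κ`.

`stub_morse` below is the line's statement with `MorseInequality` / `IsDefinitePair` / `SimpleSpectrum` /
`foldSet` / `euler` / `pairPoly` / `posRootsCard` / `pencilDet` UNFOLDED (no definitions are introduced), so the
skeleton's `sorry` closes by `exact FoldLaw.stub_morse` (δ-unfolding), exactly as for the landed
`FoldLaw.stub_perturb` (p596855) and `FoldLaw.stub_rungOne` (p596879).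

Helper mode (`--supports stmt-ValiantsHypothesis-18050 --as helper`).  Honest framing: this is the
paper-elementary structural step of a LAW line; the law `stub_foldLaw` (Conjecture-B strength), the genericity
stub `stub_generic`, Conjecture B (`KPlusLogSqLaw`), the crux `MatrixDescartes` and VP ≠ VNP are OPEN and NOT
moved by this file.
-/

set_option linter.dupNamespace false

namespace Summit.ValiantsHypothesis.ValiantsHypothesis.Theorems.LacunarySymmetroidMatrixDescartes.FoldLaw

open Polynomial Matrix
open scoped BigOperators

/-- **`stub_morse` of line «definite-pair-fold-law»** (the line's `MorseInequality`, vocabulary unfolded):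
for semidefinite letters `P_l, Q_l ⪰ 0` with `Σ P_l ≻ 0`, `Σ Q_l ≻ 0`, simple generalized spectrum of the pair
polynomial `Φ = det(Σ_l X₀^{d_l}(P_l − X₁ Q_l))` over `x > 0` and finitely many fold points
`{p | 0 < p 0 ∧ 0 < p 1 ∧ Φ(p) = 0 ∧ (X₀ ∂₀Φ)(p) = 0}`, the number of distinct positive roots of
`det(Σ_l X^{d_l}(P_l − Q_l))` is at most `m` plus the number of fold points. -/
theorem stub_morse :
    ∀ (m K : ℕ) (d : Fin K → ℕ) (P Q : Fin K → Matrix (Fin m) (Fin m) ℝ),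
      ((∀ l, (P l).PosSemidef) ∧ (∀ l, (Q l).PosSemidef) ∧ (∑ l, P l).PosDef ∧ (∑ l, Q l).PosDef) →
      (∀ p : Fin 2 → ℝ, 0 < p 0 →
        MvPolynomial.eval p
          (∑ l, (MvPolynomial.X (0 : Fin 2) : MvPolynomial (Fin 2) ℝ) ^ d l •
            ((P l).map (MvPolynomial.C : ℝ →+* MvPolynomial (Fin 2) ℝ)
              - (MvPolynomial.X (1 : Fin 2) : MvPolynomial (Fin 2) ℝ) •
                (Q l).map (MvPolynomial.C : ℝ →+* MvPolynomial (Fin 2) ℝ))).det = 0 →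
        MvPolynomial.eval p (MvPolynomial.pderiv 1
          (∑ l, (MvPolynomial.X (0 : Fin 2) : MvPolynomial (Fin 2) ℝ) ^ d l •
            ((P l).map (MvPolynomial.C : ℝ →+* MvPolynomial (Fin 2) ℝ)
              - (MvPolynomial.X (1 : Fin 2) : MvPolynomial (Fin 2) ℝ) •
                (Q l).map (MvPolynomial.C : ℝ →+* MvPolynomial (Fin 2) ℝ))).det) ≠ 0) →
      {p : Fin 2 → ℝ | 0 < p 0 ∧ 0 < p 1 ∧
        MvPolynomial.eval p
          (∑ l, (MvPolynomial.X (0 : Fin 2) : MvPolynomial (Fin 2) ℝ) ^ d l •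
            ((P l).map (MvPolynomial.C : ℝ →+* MvPolynomial (Fin 2) ℝ)
              - (MvPolynomial.X (1 : Fin 2) : MvPolynomial (Fin 2) ℝ) •
                (Q l).map (MvPolynomial.C : ℝ →+* MvPolynomial (Fin 2) ℝ))).det = 0 ∧
        MvPolynomial.eval p (MvPolynomial.X 0 * MvPolynomial.pderiv 0
          (∑ l, (MvPolynomial.X (0 : Fin 2) : MvPolynomial (Fin 2) ℝ) ^ d l •
            ((P l).map (MvPolynomial.C : ℝ →+* MvPolynomial (Fin 2) ℝ)
              - (MvPolynomial.X (1 : Fin 2) : MvPolynomial (Fin 2) ℝ) •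
                (Q l).map (MvPolynomial.C : ℝ →+* MvPolynomial (Fin 2) ℝ))).det) = 0}.Finite →
      ((∑ l, (X : ℝ[X]) ^ d l • (P l - Q l).map Polynomial.C).det.roots.toFinset.filter
          (fun t => 0 < t)).card ≤
        m + {p : Fin 2 → ℝ | 0 < p 0 ∧ 0 < p 1 ∧
          MvPolynomial.eval p
            (∑ l, (MvPolynomial.X (0 : Fin 2) : MvPolynomial (Fin 2) ℝ) ^ d l •
              ((P l).map (MvPolynomial.C : ℝ →+* MvPolynomial (Fin 2) ℝ)
                - (MvPolynomial.X (1 : Fin 2) : MvPolynomial (Fin 2) ℝ) •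
                  (Q l).map (MvPolynomial.C : ℝ →+* MvPolynomial (Fin 2) ℝ))).det = 0 ∧
          MvPolynomial.eval p (MvPolynomial.X 0 * MvPolynomial.pderiv 0
            (∑ l, (MvPolynomial.X (0 : Fin 2) : MvPolynomial (Fin 2) ℝ) ^ d l •
              ((P l).map (MvPolynomial.C : ℝ →+* MvPolynomial (Fin 2) ℝ)
                - (MvPolynomial.X (1 : Fin 2) : MvPolynomial (Fin 2) ℝ) •
                  (Q l).map (MvPolynomial.C : ℝ →+* MvPolynomial (Fin 2) ℝ))).det) = 0}.ncard := by
  intro m K d P Q hDef hSimple hFin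
  classical
  obtain ⟨hP, hQ, hPsum, hQsum⟩ := hDef
  set Φ : MvPolynomial (Fin 2) ℝ :=
    (∑ l, (MvPolynomial.X (0 : Fin 2) : MvPolynomial (Fin 2) ℝ) ^ d l •
      ((P l).map (MvPolynomial.C : ℝ →+* MvPolynomial (Fin 2) ℝ)
        - (MvPolynomial.X (1 : Fin 2) : MvPolynomial (Fin 2) ℝ) •
          (Q l).map (MvPolynomial.C : ℝ →+* MvPolynomial (Fin 2) ℝ))).det with hΦ
  -- the vertical and horizontal slices of `Φ`
  set ψ : ℝ → ℝ[X] := fun x => MvPolynomial.aeval ![Polynomial.C x, Polynomial.X] Φ with hψ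
  set η : ℝ → ℝ[X] := fun t => MvPolynomial.aeval ![Polynomial.X, Polynomial.C t] Φ with hη
  have hψη : ∀ x t, (ψ x).eval t = (η t).eval x := fun x t => by
    simp only [hψ, hη, Morse.eval_aeval_vslice, Morse.eval_aeval_hslice]
  -- the pencil `A(x) ≻ 0`, `C(x) ≻ 0`
  have hApos : ∀ x : ℝ, 0 < x → (∑ l, x ^ d l • P l).PosDef := fun x hx =>
    Morse.posDef_sum_pow_smul d P hP hPsum hx
  have hCpos : ∀ x : ℝ, 0 < x → (∑ l, x ^ d l • Q l).PosDef := fun x hx =>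
    Morse.posDef_sum_pow_smul d Q hQ hQsum hx
  have hψdet : ∀ x : ℝ, ψ x = ((∑ l, x ^ d l • P l).map Polynomial.C -
      (Polynomial.X : ℝ[X]) • (∑ l, x ^ d l • Q l).map Polynomial.C).det := fun x => by
    simp only [hψ, hΦ]
    exact Morse.aeval_vslice_pairPoly d P Q x
  have hfacts : ∀ x : ℝ, 0 < x → (ψ x).natDegree = m ∧
      (ψ x).leadingCoeff = (-1) ^ m * (∑ l, x ^ d l • Q l).det ∧ Multiset.card (ψ x).roots = m := by
    intro x hx
    rw [hψdet x]
    exact Morse.pencil_charpoly (hApos x hx).isHermitian (hCpos x hx)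
  have hdeg : ∀ x : ℝ, 0 < x → (ψ x).natDegree = m := fun x hx => (hfacts x hx).1
  have hlc : ∀ x : ℝ, 0 < x → 0 < (-1 : ℝ) ^ m * (ψ x).leadingCoeff := by
    intro x hx
    rw [(hfacts x hx).2.1]
    have : (-1 : ℝ) ^ m * ((-1) ^ m * (∑ l, x ^ d l • Q l).det) =
        ((-1 : ℝ) ^ m) ^ 2 * (∑ l, x ^ d l • Q l).det := by ring
    rw [this]
    exact mul_pos (by positivity) (hCpos x hx).det_pos
  have hψ0 : ∀ x : ℝ, 0 < x → ψ x ≠ 0 := by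
    intro x hx h0
    have := hlc x hx
    rw [h0, leadingCoeff_zero, mul_zero] at this
    exact lt_irrefl _ this
  -- simple spectrum: the `m` real roots are distinct
  have hcard : ∀ x : ℝ, 0 < x → (ψ x).roots.toFinset.card = m := by
    intro x hx
    have hnd : (ψ x).roots.Nodup := by
      rw [Multiset.nodup_iff_count_le_one]
      intro t
      rw [count_roots]
      by_contra hgt
      have h1 : 1 < (ψ x).rootMultiplicity t := by omega
      rw [one_lt_rootMultiplicity_iff_isRoot (hψ0 x hx)] at h1
      obtain ⟨hr, hdr⟩ := h1
      have hΦ0 : MvPolynomial.eval ![x, t] Φ = 0 := by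
        rw [← Morse.eval_aeval_vslice]; exact hr
      have hd0 : MvPolynomial.eval ![x, t] (MvPolynomial.pderiv 1 Φ) = 0 := by
        rw [← Morse.eval_aeval_vslice, ← Morse.derivative_aeval_vslice]; exact hdr
      exact hSimple ![x, t] (by simpa using hx) hΦ0 hd0
    rw [Multiset.toFinset_card_of_nodup hnd, (hfacts x hx).2.2]
  -- every fold of a branch is a point of the fold set
  have hF : ∀ c t : ℝ, 0 < c → (ψ c).IsRoot t → (η t).derivative.eval c = 0 →
      ![c, t] ∈ {p : Fin 2 → ℝ | 0 < p 0 ∧ 0 < p 1 ∧ MvPolynomial.eval p Φ = 0 ∧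
        MvPolynomial.eval p (MvPolynomial.X 0 * MvPolynomial.pderiv 0 Φ) = 0} := by
    intro c t hc hr hd
    simp only [Set.mem_setOf_eq]
    refine ⟨by simpa using hc, ?_, ?_, ?_⟩
    · have hdet : ((∑ l, c ^ d l • P l) - t • (∑ l, c ^ d l • Q l)).det = 0 := by
        rw [← Morse.eval_det_sub_smul, ← hψdet]; exact hr
      simpa using Morse.pos_of_det_sub_smul_eq_zero (hApos c hc) (hCpos c hc).posSemidef hdet
    · rw [← Morse.eval_aeval_vslice]; exact hr
    · rw [map_mul, MvPolynomial.eval_X, ← Morse.eval_aeval_hslice, ← Morse.derivative_aeval_hslice]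
      change (![c, t] 0) * (η t).derivative.eval c = 0
      rw [hd, mul_zero]
  have key := Morse.card_filter_pos_roots_le hψη hdeg hcard hlc hFin hF
  have hη1 : η 1 = (∑ l, (X : ℝ[X]) ^ d l • (P l - Q l).map Polynomial.C).det := by
    simp only [hη, hΦ]
    exact Morse.aeval_hslice_one_pairPoly d P Q
  rw [hη1] at key
  exact key

end Summit.ValiantsHypothesis.ValiantsHypothesis.Theorems.LacunarySymmetroidMatrixDescartes.FoldLaw
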